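/-
Copyright (c) 2026 the pub-hodgecm-mathlib formalisation cell (harness21).  Prover seat hodgecm-mathlib-K2Liu-p05 (g7), Track B «K2-LIT»,
#184♮ = hLiu418 = `stmt-HodgeConjecture-24832`; Road I v3, S5-F3 lineage ∕ I4-conv (F′-fact), file (xi): the `hFi` PAYER of ★ E-final `K2LiuKlingenInnerSectionFactorizableLine`.
-/
import Summits.HodgeConjecture.HodgeConjecture.Theorems.K2LiuKlingenInnerSectionAutomorphy   -- ★ F5-q (+ ★ F5-c, F5-e, F5-k, F5-l, F5-m, F5-p by import)
import Summits.HodgeConjecture.HodgeConjecture.Theorems.K2LiuKlingenWeightedMajorant        -- ★ I2: `exists_klingenWeight`, `lintegral_majorant_klingenWeight_ne_top` ((H) at every base point)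
import Summits.HodgeConjecture.HodgeConjecture.Theorems.K2LiuSiegelQuotSubgroupOrbitSum      -- ★ F4-2c: `exists_section_of_orbit`, `lintegral_orbit_ne_top_subgroup` (+ ★ F4-2b `exists_stabilizer_subgroupOf`)
import Summits.HodgeConjecture.HodgeConjecture.Theorems.K2LiuAdelicLatticeWeight             -- ★ F5-s: `exists_latticeWeight`
import Literature.NumberTheory.Automorphic.AdelicSecondCountable                              -- ★ `secondCountableTopology_adeleRing`
import Literature.NumberTheory.Automorphic.AdicCompletionCompact                              -- ★ `locallyCompactSpace_adeleRing'`
import HarnessLib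

/-!
# Crux `HLiu418`, I4-conv (F′-fact), file (xi) — `K2LiuKlingenInnerSectionIntegrable`: THE TERM-2 INTEGRAND IS INTEGRABLE ON THE KLINGEN FIBRE
# `q = (y, t) ↦ f(Ψ(ξ) · Ψ(n_Q(y,0,t)) · x) ∈ L¹(Y(𝔸) × 𝔸_L, μ_Y ⊗ μ_T)` for `re s > 1`, at EVERY base point `x ∈ H(𝔸)`

Cell `hodgecm-mathlib`, crux item hLiu418 = `stmt-HodgeConjecture-24832`; squad K2 ∕ K2Liu; LEAD F0P6-plan (g14) BATCH #62 (2) «(xi) `hFi` IS p05's»;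
prover K2Liu-p05 (g7).  THEOREMS ONLY (no `def`, no instance, no notation, no named-fact hypothesis, no `sorry`); lane `--supports stmt-HodgeConjecture-24832
--as helper` (count-neutral).

THE POINT.  ★ E-final `K2LiuKlingenInnerSectionFactorizableLine.exists_factorizable_line` (K2Liu-p14) asks, per `(s, g₂)`, ONE analytic input `hFi`: the integrability of
the term-2 integrand `q ↦ f_s(Ψ(ξ)·Ψ(n_Q(y_q,0,t_q))·Ψ(m_Q(1, j₂⁻¹g₂))·h)` on the Klingen fibre `(↥Y × 𝔸_L, μ_Y ⊗ μ_T)`; ★ F5-q ∕ ★ F10 ∕ ★ carrier (A)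
`K2LiuKlingenTermTwoTransport.exists_const_eisensteinSeriesU_innerSectionOrbit_eq` ask the ORBIT form `hint : ∀ x, Integrable (u ↦ β₁(u) • f(Ψ(ξ)·u·x)) νN`.
Both are the absolute convergence of the `ξ`-cell of the Klingen constant term of the Siegel Eisenstein series, and both follow from the (H)-datum already ★:
(H) at every base point for `re s > n∕2 = 1` (★ I2 `K2LiuKlingenWeightedMajorant.lintegral_majorant_klingenWeight_ne_top` on the compactly supported Klingen weight
`exists_klingenWeight`) ⟹ its ORBIT PIECE at `γ₀ = Ψ(toAdelic ξ)` for ANY stabiliser weight (★ F4-2c `K2LiuSiegelQuotSubgroupOrbitSum.lintegral_orbit_ne_top_subgroup`;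
the stabiliser ★ F4-2b `exists_stabilizer_subgroupOf`, a stabiliser weight = the Literature `unfoldWeight` of the Klingen weight over ★ `exists_section_of_orbit`)
⟹ (orbit integrability `hint`) ⟹ in the Heisenberg chart `νN = Φ_*(μ_Z ⊗ (μ_Y ⊗ μ_T))` (★ F5-k; here `νN` IS the pushed-forward product, so no Haar ∕ locally-compact
structure on `N_Q(𝔸)` is needed) the integrand is constant along the compact `u₊`-fibres (★ F5-c `apply_transport_weylXi_conj_uPlus_mul`) and the weight has CONSTANT
fibre mass `C = ∫⁻ β₀ dμ_Z ∈ (0, ∞)` (★ F5-l `lintegral_fibre_klingenChart_eq_of_weight`, ★ F5-m `stab_membership_law`, ★ F5-s `exists_latticeWeight`; `C ≠ 0` by §1),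
so Tonelli gives `C · ∫⁻ ‖f(Ψ(ξ)Ψ(n_Q(y,0,t))x)‖ₑ d(μ_Y ⊗ μ_T) < ∞`.
* §1 GENERIC: `lintegral_ne_zero_of_tsum_translate_eq_one` (an additive covering weight of a countable lattice has nonzero mass for a nonzero invariant measure —
  additive twin of ★ I2 `lintegral_coveringWeight_ne_zero`); `lintegral_ne_top_of_lintegral_prod_ne_top` (Tonelli with constant nonzero fibre mass: `∫⁻ F(p)·W(z,p) < ∞`,
  `∫⁻ W(·,p) dμ_Z = C ≠ 0` ⟹ `∫⁻ F dμ < ∞`); `isCoveringWeight_unfoldWeight_section` (a stabiliser weight from an `N(L⁺)`-weight and a section of `Stab\N(L⁺)`).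
* §2 **`integrable_innerSectionOrbit`** — ★ F5-q's ∕ (A)'s `hint` FROM `1 < re s`: for ANY left-invariant `νN` finite on compacts, ANY stabiliser lattice `Γ₁` (F5-q's
  membership law) and ANY `Γ₁`-weight `β₁`: `∀ x, Integrable (u ↦ (β₁ u).toReal • f(Ψ(jAdelic ξ)·u·x)) νN`.
* §3 **`integrable_innerSection`** — THE HEAD: `∀ x, Integrable (q ↦ f(Ψ(jAdelic ξ)·Ψ(jAdelic n_Q(y_q,0,t_q))·x)) (μ_Y ⊗ μ_T)` (instance hypotheses only
  `[MeasurableSpace 𝔸_L] [BorelSpace 𝔸_L]` and `μ_Y, μ_T` additive Haar, as ★ E-final; second countability ∕ σ-finiteness discharged inside).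
* §4 **`integrable_innerSection_termTwo`** — ★ E-final's `hFi` binder VERBATIM (`x := Ψ(jAdelic m_Q^𝔸(1, j₂⁻¹g₂))·h`, family letter `f s`).
[MoeglinWaldspurger1995, II.1.5–II.1.7], [GanTakeda2011SiegelWeil, §7.2 p. 23], [KudlaRallis1994, §2], [Weil1965, §9], [CogdellAnalyticTheory2004, §2.3].
HONEST LABEL.  Count-neutral helper, closes no socket: `HC_CM` is proved only modulo the 7 printed citations (2 remaining named inputs: hLiu418 =
`stmt-HodgeConjecture-24832`, h413 = `stmt-HodgeConjecture-24833`) until rung 0 closes.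
-/

set_option autoImplicit false
set_option linter.dupNamespace false -- the mandated namespace repeats `HodgeConjecture.HodgeConjecture`

noncomputable section

open scoped Matrix ENNReal NNReal
open NumberField IsDedekindDomain MeasureTheory MeasureTheory.Measure Function MulAction

namespace Summit.HodgeConjecture.HodgeConjecture.Cruxes.HLiu418.K2LiuKlingenInnerSectionIntegrable

open Literature.MeasureTheory.Group
open Literature.NumberTheory.Automorphic Literature.NumberTheory.Automorphic.UnitaryGroup
open Literature.NumberTheory.GelbartRogawski1991 Literature.NumberTheory.GelbartRogawski1991.GRConstruction
open Literature.NumberTheory.GaloisRepresentations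
open Literature.NumberTheory.K2Lit.SiegelDoubled
open Summit.HodgeConjecture.HodgeConjecture.Cruxes.HLiu418.K2LiuDoubledUTwoTwoBorelFrame
open Summit.HodgeConjecture.HodgeConjecture.Cruxes.HLiu418.K2LiuKlingenParabolicDefs
open Summit.HodgeConjecture.HodgeConjecture.Cruxes.HLiu418.K2LiuKlingenUnipotentDefs
open Summit.HodgeConjecture.HodgeConjecture.Cruxes.HLiu418.K2LiuKlingenUnipotentAdelicDefs
open Summit.HodgeConjecture.HodgeConjecture.Cruxes.HLiu418.K2LiuKlingenUnipotentAdelicChart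
open Summit.HodgeConjecture.HodgeConjecture.Cruxes.HLiu418.K2LiuKlingenRationalCells (complexConj_ringHom_apply_apply transport_toAdelic_mem_ratH)
open Summit.HodgeConjecture.HodgeConjecture.Cruxes.HLiu418.K2LiuSiegelDoubledUnfold (countable_ratH)
open Summit.HodgeConjecture.HodgeConjecture.Cruxes.HLiu418.K2LiuSiegelEisensteinSubgroupPeriodCells (coe_coe_mem_ratH countable_subgroupOf_ratH enorm_wt_smul_subgroup)
open Summit.HodgeConjecture.HodgeConjecture.Cruxes.HLiu418.K2LiuSiegelQuotSubgroupOrbitUnfold (exists_stabilizer_subgroupOf)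
open Summit.HodgeConjecture.HodgeConjecture.Cruxes.HLiu418.K2LiuSiegelQuotSubgroupOrbitSum (exists_section_of_orbit lintegral_orbit_ne_top_subgroup)
open Summit.HodgeConjecture.HodgeConjecture.Cruxes.HLiu418.K2LiuKlingenWeightedMajorant (exists_klingenWeight lintegral_majorant_klingenWeight_ne_top)
open Summit.HodgeConjecture.HodgeConjecture.Cruxes.HLiu418.K2LiuKlingenInnerSectionLeviLaw (apply_transport_weylXi_conj_uPlus_mul)
open Summit.HodgeConjecture.HodgeConjecture.Cruxes.HLiu418.K2LiuHeisenbergProductHaar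
  (isMulLeftInvariant_map_klingenChart isFiniteMeasureOnCompacts_map_klingenChart klingenChart_eq_uPlus_mul)
open Summit.HodgeConjecture.HodgeConjecture.Cruxes.HLiu418.K2LiuKlingenFibreMassConstant (lintegral_fibre_klingenChart_eq_of_weight)
open Summit.HodgeConjecture.HodgeConjecture.Cruxes.HLiu418.K2LiuKlingenStabiliserLattice (stab_membership_law countable_range_algebraMap)
open Summit.HodgeConjecture.HodgeConjecture.Cruxes.HLiu418.K2LiuKlingenInnerSectionBorelInvariant (toAdelic_weylXi_eq_jAdelic)
open Summit.HodgeConjecture.HodgeConjecture.Cruxes.HLiu418.K2LiuAdelicLatticeWeight (exists_latticeWeight)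
open Summit.HodgeConjecture.HodgeConjecture.Cruxes.HLiu418.K2LiuSiegelDoubledLeviMatrix (conjAdele_conjAdele')
open UnitaryDualPair

/-! ## §1 Generic lemmas -/

section Generic

/-- **an additive covering weight has nonzero mass**: `Λ ≤ A` countable, `μ ≠ 0` invariant under left translations, `β` measurable with `Σ_{l ∈ Λ} β(l + z) = 1` for
every `z` ⟹ `∫⁻ β dμ ≠ 0` (if the integral vanished, `β(l + ·) = 0` a.e. for each of the countably many `l`, so the covering sum would vanish somewhere).
Additive twin of ★ I2 `K2LiuKlingenWeightedMajorant.lintegral_coveringWeight_ne_zero`. [cite: Weil1965, §9] [cite: CogdellAnalyticTheory2004, §2.3] -/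
theorem lintegral_ne_zero_of_tsum_translate_eq_one {A : Type*} [AddGroup A] [MeasurableSpace A] [MeasurableAdd A]
    (Λ : AddSubgroup A) [Countable ↥Λ] (μ : Measure A) [μ.IsAddLeftInvariant] (hμ : μ ≠ 0)
    {β : A → ℝ≥0∞} (hβm : Measurable β) (hβ : ∀ z, ∑' l : ↥Λ, β ((l : A) + z) = 1) : ∫⁻ z, β z ∂μ ≠ 0 := by
  intro h0
  have hae : ∀ᵐ z ∂μ, β z = 0 := (lintegral_eq_zero_iff hβm).1 h0
  have hl : ∀ l : ↥Λ, ∀ᵐ z ∂μ, β ((l : A) + z) = 0 := fun l => by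
    have h := hae
    rw [← map_add_left_eq_self μ (l : A)] at h
    exact ae_of_ae_map (measurable_const_add (l : A)).aemeasurable h
  have hall : ∀ᵐ z ∂μ, ∀ l : ↥Λ, β ((l : A) + z) = 0 := ae_all_iff.2 hl
  haveI : NeZero μ := ⟨hμ⟩
  obtain ⟨z, hz⟩ := hall.exists
  have h1 := hβ z
  simp only [hz, tsum_zero] at h1
  exact zero_ne_one h1

/-- **TONELLI WITH CONSTANT NONZERO FIBRE MASS**: `F ≥ 0` measurable on `P`, `W ≥ 0` measurable on `Z × P` with `∫⁻ W(z,p) dμ_Z(z) = C ≠ 0` for every `p`; if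
`∫⁻ F(p)·W(z,p) d(μ_Z ⊗ μ) ≠ ∞` then `∫⁻ F dμ ≠ ∞` (the double integral is `C · ∫⁻ F dμ`). [cite: CogdellAnalyticTheory2004, §2.3] [cite: Weil1965, §9] -/
theorem lintegral_ne_top_of_lintegral_prod_ne_top {Z P : Type*} [MeasurableSpace Z] [MeasurableSpace P] (μZ : Measure Z) (μ : Measure P)
    [SFinite μZ] [SFinite μ] {F : P → ℝ≥0∞} (hF : Measurable F) {W : Z × P → ℝ≥0∞} (hW : Measurable W) {C : ℝ≥0∞} (hC : C ≠ 0)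
    (hfib : ∀ p, ∫⁻ z, W (z, p) ∂μZ = C) (h : ∫⁻ zp, F zp.2 * W zp ∂(μZ.prod μ) ≠ ∞) : ∫⁻ p, F p ∂μ ≠ ∞ := by
  rw [lintegral_prod_symm (fun zp : Z × P => F zp.2 * W zp) ((hF.comp measurable_snd).mul hW).aemeasurable] at h
  have hinner : ∀ p, ∫⁻ z, F (z, p).2 * W (z, p) ∂μZ = F p * C := fun p => by
    show ∫⁻ z, F p * W (z, p) ∂μZ = F p * C
    rw [lintegral_const_mul (F p) (f := fun z => W (z, p)) (hW.comp measurable_prodMk_right), hfib p]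
  simp_rw [hinner] at h
  rw [lintegral_mul_const _ hF] at h
  intro htop
  exact h (ENNReal.mul_eq_top.2 (Or.inr ⟨htop, hC⟩))

end Generic

variable {L : Type} [Field L] [NumberField L] [IsCMField L]
variable {N M : ℕ} {e : Fin N × Fin M ≃ Fin 2}
  {dV : Fin N → L} {hdV : ∀ i, IsCMField.complexConj L (dV i) = dV i}
  {dW : Fin M → L} {hdW : ∀ i, IsCMField.complexConj L (dW i) = dW i}

/-- **A STABILISER WEIGHT FROM AN `N(L⁺)`-WEIGHT AND A SECTION**: `Nsub ≤ H(𝔸)`, `β` an `N(L⁺)`-covering weight (`N(L⁺) = Nsub ∩ H(L⁺)`), `Γ' ≤ N(L⁺)` and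
`ν : ι → N(L⁺)` a section of `Γ'\N(L⁺)` (`∀ γ, ∃! i, γ ν_i⁻¹ ∈ Γ'`, `ι` countable) ⟹ the Literature `unfoldWeight β ν = Σ_i β(ν_i⁻¹ ·)` is a `Γ'`-covering weight
(Literature `coveringSum_unfoldWeight`, `measurable_unfoldWeight`). [cite: CogdellAnalyticTheory2004, §2.3] [cite: Weil1965, §9] -/
theorem isCoveringWeight_unfoldWeight_section {Nsub : Subgroup (HA L e dV hdV dW hdW)} [MeasurableSpace Nsub] [BorelSpace Nsub]
    {β : Nsub → ℝ≥0∞} (hβ : IsCoveringWeight ((ratH L e dV hdV dW hdW).subgroupOf Nsub) β)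
    (Γ' : Subgroup Nsub) (hΓ'le : Γ' ≤ (ratH L e dV hdV dW hdW).subgroupOf Nsub)
    {ι : Type*} [Countable ι] (ν : ι → (ratH L e dV hdV dW hdW).subgroupOf Nsub)
    (hν : ∀ γ ∈ (ratH L e dV hdV dW hdW).subgroupOf Nsub, ∃! i, γ * ((ν i : Nsub))⁻¹ ∈ Γ') :
    IsCoveringWeight Γ' (unfoldWeight β (fun i => ((ν i : (ratH L e dV hdV dW hdW).subgroupOf Nsub) : Nsub))) := by
  haveI : MeasurableConstSMul Nsub Nsub := ⟨fun g => measurable_const_mul g⟩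
  refine ⟨measurable_unfoldWeight hβ.1 _, fun u => ?_⟩
  rw [coveringSum_unfoldWeight ((ratH L e dV hdV dW hdW).subgroupOf Nsub) Γ' hΓ'le β (fun i => (ν i).2) hν u]
  exact hβ.2 u

section Transport

variable {SA : GL (Fin (2 + 2)) (AdeleRing (𝓞 L) L)}
  {Ψ : (quasiSplit (Fp L) L (IsCMField.complexConj L) (2 + 2)).Adelic ≃ₜ* HA L e dV hdV dW hdW} {X Y : Matrix (Fin 2) (Fin 2) (Fp L)} {a : Fp L}
  (hΨ : ∀ g : (quasiSplit (Fp L) L (IsCMField.complexConj L) (2 + 2)).Adelic,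
    (((Ψ g : HA L e dV hdV dW hdW) : GL (Fin (2 + 2)) (AdeleRing (𝓞 L) L)) : Matrix (Fin (2 + 2)) (Fin (2 + 2)) (AdeleRing (𝓞 L) L)) =
      (SA : Matrix (Fin (2 + 2)) (Fin (2 + 2)) (AdeleRing (𝓞 L) L)) *
        ((adelicVal (Fp L) L (IsCMField.complexConj L) (2 + 2) _ g : GL (Fin (2 + 2)) (AdeleRing (𝓞 L) L)) :
          Matrix (Fin (2 + 2)) (Fin (2 + 2)) (AdeleRing (𝓞 L) L)) *
        ((SA⁻¹ : GL (Fin (2 + 2)) (AdeleRing (𝓞 L) L)) : Matrix (Fin (2 + 2)) (Fin (2 + 2)) (AdeleRing (𝓞 L) L)))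
  (ha : a + a = 1)
  (hSA : Matrix.reindex (e₂ (n := 2)).symm (e₂ (n := 2)).symm (SA : Matrix (Fin (2 + 2)) (Fin (2 + 2)) (AdeleRing (𝓞 L) L)) =
    Matrix.fromBlocks (1 : Matrix (Fin 2) (Fin 2) (AdeleRing (𝓞 L) L)) (X.map ((algebraMap L (AdeleRing (𝓞 L) L)).comp (algebraMap (Fp L) L))) 1
      (-(X.map ((algebraMap L (AdeleRing (𝓞 L) L)).comp (algebraMap (Fp L) L)))))
  (hSAi : Matrix.reindex (e₂ (n := 2)).symm (e₂ (n := 2)).symm ((SA⁻¹ : GL (Fin (2 + 2)) (AdeleRing (𝓞 L) L)) : Matrix (Fin (2 + 2)) (Fin (2 + 2)) (AdeleRing (𝓞 L) L)) =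
    Matrix.fromBlocks ((a • (1 : Matrix (Fin 2) (Fin 2) (Fp L))).map ((algebraMap L (AdeleRing (𝓞 L) L)).comp (algebraMap (Fp L) L)))
      ((a • (1 : Matrix (Fin 2) (Fin 2) (Fp L))).map ((algebraMap L (AdeleRing (𝓞 L) L)).comp (algebraMap (Fp L) L)))
      (Y.map ((algebraMap L (AdeleRing (𝓞 L) L)).comp (algebraMap (Fp L) L)))
      (-(Y.map ((algebraMap L (AdeleRing (𝓞 L) L)).comp (algebraMap (Fp L) L)))))
  (hXY : X * Y = a • (1 : Matrix (Fin 2) (Fin 2) (Fp L))) (hYX : Y * X = a • (1 : Matrix (Fin 2) (Fin 2) (Fp L)))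
  (hΨP : ∀ b : (quasiSplit (Fp L) L (IsCMField.complexConj L) (2 + 2)).Adelic,
    ((adelicVal (Fp L) L (IsCMField.complexConj L) (2 + 2) _ b : GL (Fin (2 + 2)) (AdeleRing (𝓞 L) L)) :
        Matrix (Fin (2 + 2)) (Fin (2 + 2)) (AdeleRing (𝓞 L) L)).BlockTriangular id →
      IsSiegelDelta L e dV hdV dW hdW (Ψ b))

/-! ## §2 The orbit integrand of the `ξ`-cell is integrable for `re s > 1` (★ F5-q's `hint`) -/

include hΨ ha hSA hSAi hXY hYX in
/-- **(xi) §2 — ★ F5-q's ∕ ★ (A)'s `hint` FROM `1 < re s`.**  `νN` ANY left-invariant measure on `N_Q(𝔸) = klingenUnipA Ψ` finite on compact sets, `Γ₁` the stabiliser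
lattice of the `ξ`-cell (★ F5-a's membership law, BY VALUE) with ANY `Γ₁`-covering weight `β₁`, `χ` unitary, `1 < re s`, `f` a continuous Siegel section of `I_Δ(s,χ)`:
for EVERY `x ∈ H(𝔸)`, `u ↦ β₁(u) • f(Ψ(jAdelic ξ)·u·x)` is `νN`-integrable — (H) at `x` on the Klingen weight (★ I2), its orbit piece at `γ₀ = Ψ(toAdelic ξ)` (★ F4-2c), and
`‖β₁ • z‖ₑ = ‖z‖ₑ·β₁`. [cite: MoeglinWaldspurger1995, II.1.5, II.1.7] [cite: KudlaRallis1994, §2] [cite: GanTakeda2011SiegelWeil, §7.2 p. 23] -/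
theorem integrable_innerSectionOrbit (hdV0 : ∀ i, dV i ≠ 0) (hdW0 : ∀ i, dW i ≠ 0)
    [MeasurableSpace ↥(klingenUnipA Ψ)] [BorelSpace ↥(klingenUnipA Ψ)] (νN : Measure ↥(klingenUnipA Ψ)) [νN.IsMulLeftInvariant] [IsFiniteMeasureOnCompacts νN]
    (Γ₁ : Subgroup ↥(klingenUnipA Ψ))
    (hΓ₁ : ∀ u : ↥(klingenUnipA Ψ), u ∈ Γ₁ ↔ (u : HA L e dV hdV dW hdW) ∈ ratH L e dV hdV dW hdW ∧
      IsSiegelDelta L e dV hdV dW hdW (Ψ (UnitaryGroup.toAdelic (Fp L) L (IsCMField.complexConj L) (2 + 2) ((StdForm.antidiagonal (2 + 2)).over L) (weylXi L ((IsCMField.complexConj L : L ≃ₐ[Fp L] L) : L →+* L))) * (u : HA L e dV hdV dW hdW) * (Ψ (UnitaryGroup.toAdelic (Fp L) L (IsCMField.complexConj L) (2 + 2) ((StdForm.antidiagonal (2 + 2)).over L) (weylXi L ((IsCMField.complexConj L : L ≃ₐ[Fp L] L) : L →+* L))))⁻¹))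
    {β₁ : ↥(klingenUnipA Ψ) → ℝ≥0∞} (hβ₁ : IsCoveringWeight ↥Γ₁ β₁)
    {χ : HeckeCharacter L} (hχ : χ.IsUnitary) {s : ℂ} (hs : 1 < s.re)
    {f : HA L e dV hdV dW hdW → ℂ} (hf : IsSiegelDeltaSection L e dV hdV dW hdW χ s f) (hfc : Continuous f) (x : HA L e dV hdV dW hdW) :
    Integrable (fun u : ↥(klingenUnipA Ψ) => (β₁ u).toReal •
      f (Ψ (jAdelic L 4 (weylXi (AdeleRing (𝓞 L) L) (conjAdele (Fp L) L (IsCMField.complexConj L)))) * (u : HA L e dV hdV dW hdW) * x)) νN := by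
  haveI : Countable (ratH L e dV hdV dW hdW) := countable_ratH L e dV hdV dW hdW
  haveI : Countable (SiegelDeltaQuot L e dV hdV dW hdW) := by unfold SiegelDeltaQuot; exact inferInstance
  -- the Klingen weight and (H) at the base point `x` (★ I2)
  obtain ⟨β, hβ, ⟨K, hK, hβK⟩, -⟩ := exists_klingenWeight hΨ ha hSA hSAi hXY hYX
  have hs' : (2 : ℝ) / 2 < s.re := by norm_num; exact hs
  have hH := lintegral_majorant_klingenWeight_ne_top (Ψ := Ψ) hdV0 hdW0 νN hχ hs' hf hfc hK hβK x
  -- the rational point `γ₀ = Ψ(toAdelic ξ)` and its stabiliser law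
  set γ₀ : ratH L e dV hdV dW hdW := ⟨Ψ (UnitaryGroup.toAdelic (Fp L) L (IsCMField.complexConj L) (2 + 2) ((StdForm.antidiagonal (2 + 2)).over L)
      (weylXi L ((IsCMField.complexConj L : L ≃ₐ[Fp L] L) : L →+* L))), transport_toAdelic_mem_ratH hΨ ha hSA hSAi hXY hYX _⟩ with hγ₀
  have hΓ' : ∀ u : ↥(klingenUnipA Ψ), u ∈ Γ₁ ↔ (u : HA L e dV hdV dW hdW) ∈ ratH L e dV hdV dW hdW ∧
      IsSiegelDelta L e dV hdV dW hdW ((γ₀ : HA L e dV hdV dW hdW) * (u : HA L e dV hdV dW hdW) * ((γ₀ : HA L e dV hdV dW hdW))⁻¹) := hΓ₁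
  -- the orbit piece of (H) (a sub-series of (H))
  have hO : ∫⁻ u, (∑' q : ↥(Set.range (fun γ : (ratH L e dV hdV dW hdW).subgroupOf (klingenUnipA Ψ) =>
        (Quotient.mk (MulAction.orbitRel (siegelDeltaRat L e dV hdV dW hdW) (ratH L e dV hdV dW hdW))
          (⟨(γ₀ : HA L e dV hdV dW hdW) * ((γ : ↥(klingenUnipA Ψ)) : HA L e dV hdV dW hdW), mul_mem γ₀.2 (coe_coe_mem_ratH γ)⟩ : ratH L e dV hdV dW hdW) :
            SiegelDeltaQuot L e dV hdV dW hdW))),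
        ‖f (((Quotient.out q.1 : ratH L e dV hdV dW hdW) : HA L e dV hdV dW hdW) * ((u : HA L e dV hdV dW hdW) * x))‖ₑ) * β u ∂νN ≠ ∞ := by
    refine ne_top_of_le_ne_top hH (lintegral_mono fun u => mul_le_mul' ?_ le_rfl)
    exact ENNReal.tsum_comp_le_tsum_of_injective Subtype.val_injective
      (fun q : SiegelDeltaQuot L e dV hdV dW hdW => ‖f (((Quotient.out q : ratH L e dV hdV dW hdW) : HA L e dV hdV dW hdW) * ((u : HA L e dV hdV dW hdW) * x))‖ₑ)
  have horb := lintegral_orbit_ne_top_subgroup νN hβ hf hfc γ₀ x Γ₁ hΓ' hβ₁ hO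
  -- `Ψ(toAdelic ξ) = Ψ(jAdelic ξ)` and `‖β₁ • z‖ₑ = ‖z‖ₑ · β₁`
  rw [← toAdelic_weylXi_eq_jAdelic]
  refine ⟨(hβ₁.1.ennreal_toReal.smul (hfc.comp ((continuous_const.mul continuous_subtype_val).mul continuous_const)).measurable).aestronglyMeasurable, ?_⟩
  rw [hasFiniteIntegral_iff_enorm]
  simp_rw [enorm_wt_smul_subgroup hβ₁]
  exact lt_top_iff_ne_top.2 horb

/-! ## §3 THE HEAD: the fibre integrand is integrable on `(↥Y × 𝔸_L, μ_Y ⊗ μ_T)` -/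

include hΨ ha hSA hSAi hXY hYX hΨP in
/-- **(xi) §3 — THE TERM-2 INTEGRAND IS INTEGRABLE ON THE KLINGEN FIBRE, AT EVERY BASE POINT.**  Transport pins (T1)(T3)(T4) of ★ F3 BY VALUE (★ F5-q's letters),
`dV, dW` nonvanishing, `Y ≤ 𝔸_L` the skew part (`hY`) with additive Haar measures `μ_Y` on `↥Y` and `μ_T` on `𝔸_L`, `χ` unitary, `1 < re s`, `f` a continuous Siegel
section of `I_Δ(s,χ)`.  THEN for every `x ∈ H(𝔸)`:
  `Integrable (q ↦ f(Ψ(jAdelic ξ) · Ψ(jAdelic n_Q(y_q, 0, t_q)) · x)) (μ_Y ⊗ μ_T)`.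
PROOF: §2 for `νN := Φ_*(μ_T ⊗ (μ_Y ⊗ μ_T))` (★ F5-k: left-invariant, finite on compacts) and the stabiliser weight of §1; in the chart the integrand is constant along the
`u₊`-fibres (★ F5-c) and the weight has constant fibre mass `∫⁻ β₀ dμ_T ∈ (0,∞)` (★ F5-l∕m∕s, §1), so §1's Tonelli lemma applies.
[cite: MoeglinWaldspurger1995, II.1.7] [cite: GanTakeda2011SiegelWeil, §7.2 p. 23] [cite: Weil1965, §9] [cite: CogdellAnalyticTheory2004, §2.3] -/
theorem integrable_innerSection (hdV0 : ∀ i, dV i ≠ 0) (hdW0 : ∀ i, dW i ≠ 0)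
    [MeasurableSpace (AdeleRing (𝓞 L) L)] [BorelSpace (AdeleRing (𝓞 L) L)]
    (Y : AddSubgroup (AdeleRing (𝓞 L) L)) (hY : ∀ y, y ∈ Y ↔ conjAdele (Fp L) L (IsCMField.complexConj L) y = -y)
    (μY : Measure ↥Y) (μT : Measure (AdeleRing (𝓞 L) L)) [μY.IsAddHaarMeasure] [μT.IsAddHaarMeasure]
    {χ : HeckeCharacter L} (hχ : χ.IsUnitary) {s : ℂ} (hs : 1 < s.re)
    {f : HA L e dV hdV dW hdW → ℂ} (hf : IsSiegelDeltaSection L e dV hdV dW hdW χ s f) (hfc : Continuous f) (x : HA L e dV hdV dW hdW) :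
    Integrable (fun q : ↥Y × AdeleRing (𝓞 L) L =>
      f (Ψ (jAdelic L 4 (weylXi (AdeleRing (𝓞 L) L) (conjAdele (Fp L) L (IsCMField.complexConj L)))) *
        Ψ (jAdelic L 4 (nKlingen (AdeleRing (𝓞 L) L) (conjAdele (Fp L) L (IsCMField.complexConj L)) (conjAdele_conjAdele' L)
          (((q.1 : ↥Y) : AdeleRing (𝓞 L) L)) ((hY _).1 q.1.2) 0 q.2)) * x)) (μY.prod μT) := by
  classical
  haveI : Countable (ratH L e dV hdV dW hdW) := countable_ratH L e dV hdV dW hdW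
  haveI : Countable (SiegelDeltaQuot L e dV hdV dW hdW) := by unfold SiegelDeltaQuot; exact inferInstance
  haveI : Countable ↥((algebraMap L (AdeleRing (𝓞 L) L)).toAddMonoidHom.range) := countable_range_algebraMap (L := L)
  -- topology ∕ measure bookkeeping on `𝔸_L`, `↥Y`, `N_Q(𝔸)`
  haveI := secondCountableTopology_adeleRing (K := L)
  haveI := locallyCompactSpace_adeleRing' L
  haveI : T2Space (AdeleRing (𝓞 L) L) := t2Space_adeleRing_of_numberField L
  have hYc : IsClosed (Y : Set (AdeleRing (𝓞 L) L)) := by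
    rw [show (Y : Set (AdeleRing (𝓞 L) L)) = {y | conjAdele (Fp L) L (IsCMField.complexConj L) y = -y} from Set.ext fun y => hY y]
    exact isClosed_eq (continuous_conjAdele (Fp L) L (IsCMField.complexConj L)) continuous_neg
  haveI : SecondCountableTopology ↥Y := TopologicalSpace.Subtype.secondCountableTopology (Y : Set (AdeleRing (𝓞 L) L))
  haveI : LocallyCompactSpace ↥Y := hYc.locallyCompactSpace
  letI : MeasurableSpace ↥(klingenUnipA Ψ) := borel _
  haveI : BorelSpace ↥(klingenUnipA Ψ) := ⟨rfl⟩
  -- the measure `νN := Φ_*(μ_T ⊗ (μ_Y ⊗ μ_T))` on `N_Q(𝔸)` (★ F5-k)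
  obtain ⟨νN, hνN⟩ : ∃ νN : Measure ↥(klingenUnipA Ψ), νN = Measure.map (fun p : AdeleRing (𝓞 L) L × (↥Y × AdeleRing (𝓞 L) L) =>
        (⟨Ψ (jAdelic L 4 (nKlingen (AdeleRing (𝓞 L) L) (conjAdele (Fp L) L (IsCMField.complexConj L)) (conjAdele_conjAdele' L)
            (p.2.1 : AdeleRing (𝓞 L) L) ((hY _).1 p.2.1.2) p.1 p.2.2)), transport_nKlingen_mem Ψ _ _ _ _⟩ : ↥(klingenUnipA Ψ))) (μT.prod (μY.prod μT)) := ⟨_, rfl⟩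
  haveI : νN.IsMulLeftInvariant := by rw [hνN]; exact isMulLeftInvariant_map_klingenChart hΨ Y hY μT μY μT
  haveI : IsFiniteMeasureOnCompacts νN := by rw [hνN]; exact isFiniteMeasureOnCompacts_map_klingenChart hΨ Y hY μT μY μT
  -- the Klingen weight, the stabiliser of `γ₀ = Ψ(toAdelic ξ)`, a section of `Stab\N_Q(L⁺)` and the stabiliser weight
  obtain ⟨β, hβ, -, -⟩ := exists_klingenWeight hΨ ha hSA hSAi hXY hYX
  set γ₀ : ratH L e dV hdV dW hdW := ⟨Ψ (UnitaryGroup.toAdelic (Fp L) L (IsCMField.complexConj L) (2 + 2) ((StdForm.antidiagonal (2 + 2)).over L)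
      (weylXi L ((IsCMField.complexConj L : L ≃ₐ[Fp L] L) : L →+* L))), transport_toAdelic_mem_ratH hΨ ha hSA hSAi hXY hYX _⟩ with hγ₀
  obtain ⟨Γ₁, hΓ₁le, hΓ₁⟩ := exists_stabilizer_subgroupOf (klingenUnipA Ψ) γ₀
  obtain ⟨ν, -, hν⟩ := exists_section_of_orbit γ₀ Γ₁ hΓ₁
  have hβ₁ := isCoveringWeight_unfoldWeight_section hβ Γ₁ hΓ₁le (fun q => ν q) hν
  -- §2: the orbit integrand is integrable for `νN`
  have hint := integrable_innerSectionOrbit hΨ ha hSA hSAi hXY hYX hdV0 hdW0 νN Γ₁ hΓ₁ hβ₁ hχ hs hf hfc x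
  -- its `L¹` size, read in the chart
  have hΦc := continuous_klingenChart Ψ hΨ Y hY
  have hgc : Continuous fun u : ↥(klingenUnipA Ψ) =>
      f (Ψ (jAdelic L 4 (weylXi (AdeleRing (𝓞 L) L) (conjAdele (Fp L) L (IsCMField.complexConj L)))) * (u : HA L e dV hdV dW hdW) * x) :=
    hfc.comp ((continuous_const.mul continuous_subtype_val).mul continuous_const)
  have hfin : ∫⁻ u, ‖f (Ψ (jAdelic L 4 (weylXi (AdeleRing (𝓞 L) L) (conjAdele (Fp L) L (IsCMField.complexConj L)))) * (u : HA L e dV hdV dW hdW) * x)‖ₑ *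
      unfoldWeight β (fun q => ((ν q : (ratH L e dV hdV dW hdW).subgroupOf (klingenUnipA Ψ)) : ↥(klingenUnipA Ψ))) u ∂νN ≠ ∞ := by
    have h := hint.2
    rw [hasFiniteIntegral_iff_enorm] at h
    simp_rw [enorm_wt_smul_subgroup hβ₁] at h
    exact h.ne
  rw [hνN, lintegral_map (f := fun u : ↥(klingenUnipA Ψ) =>
      ‖f (Ψ (jAdelic L 4 (weylXi (AdeleRing (𝓞 L) L) (conjAdele (Fp L) L (IsCMField.complexConj L)))) * (u : HA L e dV hdV dW hdW) * x)‖ₑ *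
        unfoldWeight β (fun q => ((ν q : (ratH L e dV hdV dW hdW).subgroupOf (klingenUnipA Ψ)) : ↥(klingenUnipA Ψ))) u)
    ((hgc.measurable.enorm).mul hβ₁.1) hΦc.measurable] at hfin
  -- along the fibres the integrand is constant (★ F5-c): `f(Ψξ · Φ(z,p) · x) = f(Ψξ · Ψ(n_Q(y_p,0,t_p)) · x)`
  have hval : ∀ zp : AdeleRing (𝓞 L) L × (↥Y × AdeleRing (𝓞 L) L),
      f (Ψ (jAdelic L 4 (weylXi (AdeleRing (𝓞 L) L) (conjAdele (Fp L) L (IsCMField.complexConj L)))) *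
        (((⟨Ψ (jAdelic L 4 (nKlingen (AdeleRing (𝓞 L) L) (conjAdele (Fp L) L (IsCMField.complexConj L)) (conjAdele_conjAdele' L)
            (zp.2.1 : AdeleRing (𝓞 L) L) ((hY _).1 zp.2.1.2) zp.1 zp.2.2)), transport_nKlingen_mem Ψ _ _ _ _⟩ : ↥(klingenUnipA Ψ)) : ↥(klingenUnipA Ψ)) :
            HA L e dV hdV dW hdW) * x) =
      f (Ψ (jAdelic L 4 (weylXi (AdeleRing (𝓞 L) L) (conjAdele (Fp L) L (IsCMField.complexConj L)))) *
        Ψ (jAdelic L 4 (nKlingen (AdeleRing (𝓞 L) L) (conjAdele (Fp L) L (IsCMField.complexConj L)) (conjAdele_conjAdele' L)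
          (((zp.2.1 : ↥Y) : AdeleRing (𝓞 L) L)) ((hY _).1 zp.2.1.2) 0 zp.2.2)) * x) := fun zp => by
    rw [klingenChart_eq_uPlus_mul Ψ Y hY zp]
    have hrew : Ψ (jAdelic L 4 (weylXi (AdeleRing (𝓞 L) L) (conjAdele (Fp L) L (IsCMField.complexConj L)))) *
        (Ψ (jAdelic L 4 (uPlus (AdeleRing (𝓞 L) L) (conjAdele (Fp L) L (IsCMField.complexConj L)) (conjAdele_conjAdele' L) zp.1)) *
          Ψ (jAdelic L 4 (nKlingen (AdeleRing (𝓞 L) L) (conjAdele (Fp L) L (IsCMField.complexConj L)) (conjAdele_conjAdele' L)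
            (((zp.2.1 : ↥Y) : AdeleRing (𝓞 L) L)) ((hY _).1 zp.2.1.2) 0 zp.2.2))) * x =
        Ψ (jAdelic L 4 (weylXi (AdeleRing (𝓞 L) L) (conjAdele (Fp L) L (IsCMField.complexConj L)) *
            uPlus (AdeleRing (𝓞 L) L) (conjAdele (Fp L) L (IsCMField.complexConj L)) (conjAdele_conjAdele' L) zp.1 *
            (weylXi (AdeleRing (𝓞 L) L) (conjAdele (Fp L) L (IsCMField.complexConj L)))⁻¹)) *
          (Ψ (jAdelic L 4 (weylXi (AdeleRing (𝓞 L) L) (conjAdele (Fp L) L (IsCMField.complexConj L)))) *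
            Ψ (jAdelic L 4 (nKlingen (AdeleRing (𝓞 L) L) (conjAdele (Fp L) L (IsCMField.complexConj L)) (conjAdele_conjAdele' L)
              (((zp.2.1 : ↥Y) : AdeleRing (𝓞 L) L)) ((hY _).1 zp.2.1.2) 0 zp.2.2)) * x) := by
      rw [map_mul, map_mul, map_mul, map_mul, map_inv, map_inv]
      simp only [mul_assoc, inv_mul_cancel_left]
    rw [hrew]
    exact apply_transport_weylXi_conj_uPlus_mul hΨ ha hSA hSAi hΨP hf zp.1 _
  simp_rw [hval] at hfin
  -- the fibre mass of the stabiliser weight is the constant `∫⁻ β₀ dμ_T ∈ (0, ∞)` (★ F5-l ∕ F5-m ∕ F5-s, §1)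
  obtain ⟨β₀, hβ₀m, hβ₀, -⟩ := exists_latticeWeight (K := L) μT
  have hΓΛ := stab_membership_law hΨ ha hSA hSAi hXY hYX Γ₁ hΓ₁
  have hfib : ∀ p : ↥Y × AdeleRing (𝓞 L) L, ∫⁻ z, unfoldWeight β (fun q => ((ν q : (ratH L e dV hdV dW hdW).subgroupOf (klingenUnipA Ψ)) : ↥(klingenUnipA Ψ)))
      ((⟨Ψ (jAdelic L 4 (nKlingen (AdeleRing (𝓞 L) L) (conjAdele (Fp L) L (IsCMField.complexConj L)) (conjAdele_conjAdele' L)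
            ((p).1 : AdeleRing (𝓞 L) L) ((hY _).1 (p).1.2) (z) (p).2)), transport_nKlingen_mem Ψ _ _ _ _⟩ : ↥(klingenUnipA Ψ))) ∂μT = ∫⁻ z, β₀ z ∂μT :=
    fun p => lintegral_fibre_klingenChart_eq_of_weight hΨ Y hY _ Γ₁ hΓΛ hβ₁ μT hβ₀m hβ₀ p
  have hC0 : ∫⁻ z, β₀ z ∂μT ≠ 0 :=
    lintegral_ne_zero_of_tsum_translate_eq_one _ μT (NeZero.ne μT) hβ₀m hβ₀
  -- Tonelli (§1): the fibre integrand has finite `L¹` size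
  have hFc : Continuous fun q : ↥Y × AdeleRing (𝓞 L) L =>
      f (Ψ (jAdelic L 4 (weylXi (AdeleRing (𝓞 L) L) (conjAdele (Fp L) L (IsCMField.complexConj L)))) *
        Ψ (jAdelic L 4 (nKlingen (AdeleRing (𝓞 L) L) (conjAdele (Fp L) L (IsCMField.complexConj L)) (conjAdele_conjAdele' L)
          (((q.1 : ↥Y) : AdeleRing (𝓞 L) L)) ((hY _).1 q.1.2) 0 q.2)) * x) :=
    hfc.comp ((continuous_const.mul (continuous_transport_nKlingen hΨ _ (continuous_subtype_val.comp continuous_fst) continuous_const continuous_snd)).mul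
      continuous_const)
  have hI : ∫⁻ q, ‖f (Ψ (jAdelic L 4 (weylXi (AdeleRing (𝓞 L) L) (conjAdele (Fp L) L (IsCMField.complexConj L)))) *
        Ψ (jAdelic L 4 (nKlingen (AdeleRing (𝓞 L) L) (conjAdele (Fp L) L (IsCMField.complexConj L)) (conjAdele_conjAdele' L)
          (((q.1 : ↥Y) : AdeleRing (𝓞 L) L)) ((hY _).1 q.1.2) 0 q.2)) * x)‖ₑ ∂(μY.prod μT) ≠ ∞ :=
    lintegral_ne_top_of_lintegral_prod_ne_top μT (μY.prod μT) hFc.measurable.enorm (hβ₁.1.comp hΦc.measurable) hC0 hfib hfin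
  exact ⟨hFc.aestronglyMeasurable, hasFiniteIntegral_iff_enorm.2 (lt_top_iff_ne_top.2 hI)⟩

/-! ## §4 ★ E-final's `hFi` binder, verbatim -/

include hΨ ha hSA hSAi hXY hYX hΨP in
/-- **(xi) §4 — THE `hFi` BINDER OF ★ E-final `K2LiuKlingenInnerSectionFactorizableLine.exists_factorizable_line`, VERBATIM**, for a family `f : ℂ → H(𝔸) → ℂ` whose
member `f s` is a continuous Siegel section of `I_Δ(s,χ)` (`χ` unitary, `1 < re s`): the term-2 integrand
`q ↦ f s (Ψ(jAdelic ξ) · Ψ(jAdelic n_Q(y_q,0,t_q)) · (Ψ(jAdelic m_Q^𝔸(1, j₂⁻¹ g₂)) · h))` is `μ_Y ⊗ μ_T`-integrable for every `h ∈ H(𝔸)`, `g₂ ∈ U(J₂)(𝔸)`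
(§3 at `x := Ψ(jAdelic m_Q^𝔸(1, j₂⁻¹ g₂)) · h`). [cite: MoeglinWaldspurger1995, II.1.7] [cite: GanTakeda2011SiegelWeil, §7.2 p. 23] [cite: Tan1999, §1] -/
theorem integrable_innerSection_termTwo (hdV0 : ∀ i, dV i ≠ 0) (hdW0 : ∀ i, dW i ≠ 0)
    [MeasurableSpace (AdeleRing (𝓞 L) L)] [BorelSpace (AdeleRing (𝓞 L) L)]
    (Y : AddSubgroup (AdeleRing (𝓞 L) L)) (hY : ∀ y, y ∈ Y ↔ conjAdele (Fp L) L (IsCMField.complexConj L) y = -y)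
    (μY : Measure ↥Y) (μT : Measure (AdeleRing (𝓞 L) L)) [μY.IsAddHaarMeasure] [μT.IsAddHaarMeasure]
    {χ : HeckeCharacter L} (hχ : χ.IsUnitary) (f : ℂ → HA L e dV hdV dW hdW → ℂ) (s : ℂ) (hs : 1 < s.re)
    (hf : IsSiegelDeltaSection L e dV hdV dW hdW χ s (f s)) (hfc : Continuous (f s))
    (h : HA L e dV hdV dW hdW) (g₂ : (quasiSplit (Fp L) L (IsCMField.complexConj L) 2).Adelic) :
    Integrable (fun q : ↥Y × AdeleRing (𝓞 L) L =>
      f s (Ψ (jAdelic L 4 (weylXi (AdeleRing (𝓞 L) L) (conjAdele (Fp L) L (IsCMField.complexConj L)))) *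
        Ψ (jAdelic L 4 (nKlingen (AdeleRing (𝓞 L) L) (conjAdele (Fp L) L (IsCMField.complexConj L)) (conjAdele_conjAdele' L)
          (((q.1 : ↥Y) : AdeleRing (𝓞 L) L)) ((hY _).1 q.1.2) 0 q.2)) *
        (Ψ (jAdelic L 4 (klingenLevi (AdeleRing (𝓞 L) L) (conjAdele (Fp L) L (IsCMField.complexConj L)) (conjAdele_conjAdele' L) 1 ((jAdelic L 2).symm g₂))) * h))) (μY.prod μT) :=
  integrable_innerSection hΨ ha hSA hSAi hXY hYX hΨP hdV0 hdW0 Y hY μY μT hχ hs hf hfc _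

end Transport

end Summit.HodgeConjecture.HodgeConjecture.Cruxes.HLiu418.K2LiuKlingenInnerSectionIntegrable

end
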